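import Literature.NumberTheory.Sieve.AletheiaZomleferFukshanskyGarcia2020
import Literature.NumberTheory.LFunctions.MertensFormula
import Literature.NumberTheory.LFunctions.PrimeNumberTheoremErrorTerm
import Literature.NumberTheory.LFunctions.PrimeIdealTheoremProofs
import HarnessLib

/-!
# Discharge of the two Mertens theorems of AZFG 2020, §5.3 (Thm. 5.3.2 over `ℚ`, Thm. 5.3.4 over a number field)

Topic: `Literature/NumberTheory/Sieve`. Sibling proof file of
`AletheiaZomleferFukshanskyGarcia2020.lean`; everything here is PROVED (no named facts, no `sorry`).

* `Literature.NumberTheory.Sieve.mertens_sum_inv_primes_holds` — the named fact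
  `Literature.NumberTheory.Sieve.mertens_sum_inv_primes`
  (`∃ B C, ∀ x ≥ 2, |∑_{p ≤ x} 1/p − log log x − B| ≤ C/log x`; AZFG 2020 Thm. 5.3.2 = Mertens 1874)
  from the tree's Mertens files `Literature/NumberTheory/LFunctions/MertensConstant.lean` (Hardy–Wright
  Thms 427–428: the constant `B₁ = γ + ∑_p (log(1 − 1/p) + 1/p)`,
  `Literature.NumberTheory.LFunctions.Mertens.meisselMertens`) and `MertensFormula.lean`
  (`Literature.NumberTheory.LFunctions.Mertens.abs_primeRecipSum_sub_le`: the rate `8/log x` for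
  `x ≥ 2`, Hardy–Wright (22.7.4)), with `B = B₁` and `C = 8`.
* `Literature.NumberTheory.Sieve.mertens_sum_inv_primeIdeals_holds` — the named fact
  `Literature.NumberTheory.Sieve.mertens_sum_inv_primeIdeals` (**Mertens' theorem for number
  fields**, AZFG 2020 Thm. 5.3.4, there credited to Rosen 1999 and Lebacque 2007): for every number
  field `K` there are `C_K, D_K` with `|∑_{N𝔭 ≤ x} 1/N𝔭 − log log x − C_K| ≤ D_K/log x` for all
  `x ≥ 2`. PROVED here by ONE partial summation from the tree's PROVED `θ_K`-form of the prime
  ideal theorem with de la Vallée-Poussin error term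
  (`Literature.NumberTheory.LFunctions.NumberField.chebyshevThetaPrimeIdealTheorem_holds`,
  `PrimeIdealTheoremProofs.lean`; Landau 1903, Montgomery–Vaughan Thm 8.9), of which only the
  consequence `|θ_K(t) − t| ≤ C t/log t` is used (`logPow_of_expSqrt`). The source (§5.3) gives no
  proof ("it is not surprising to find an analogue of Mertens' theorem that holds for prime ideals
  [Rosen], [Lebacque]"); Rosen and Lebacque likewise derive it from the prime ideal theorem.

## The partial summation (namespace `Literature.NumberTheory.Sieve.MertensNumberField`)

With `G(n) = #{𝔭 : N𝔭 = n}` (`normPrimeIdealCount`), `θ_K(x) = ∑_{n ≤ x} G(n) log n`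
(`chebyshevThetaIdeal`), `R(t) = θ_K(t) − t` and the Abel weight
`w(t) = (log t + 1)/(t² log² t) = −(d/dt)(t log t)⁻¹`:

* `sum_inv_absNorm_eq_sum_div` — `∑_{N𝔭 ≤ x} 1/N𝔭 = ∑_{n ≤ x} G(n)/n`;
* `sum_div_eq_theta_div_add_integral` — Abel summation with `a_n = G(n) log n`, `f(t) = (t log t)⁻¹`:
  `∑_{n ≤ x} G(n)/n = θ_K(x)/(x log x) + ∫₂ˣ θ_K(t) w(t) dt` (all real `x`; both sides vanish for `x < 2`);
* `integral_self_mul_abelWeight` — `∫₂ˣ t w(t) dt = [log log t − 1/log t]₂ˣ`, so the `1/log x` of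
  the boundary term `θ_K(x)/(x log x) = 1/log x + R(x)/(x log x)` cancels and
  `∑_{N𝔭 ≤ x} 1/N𝔭 − log log x − C_K = R(x)/(x log x) − ∫ₓ^∞ R w`
  (`sum_inv_absNorm_sub_loglog_sub_eq`) with `C_K = 1/log 2 − log log 2 + ∫₂^∞ R w`;
* `|R(t)| ≤ C t/log t` gives `|R w| ≤ C(1 + 1/log 2) · t⁻¹/log² t`, `∫ₓ^∞ dt/(t log² t) = 1/log x`
  (`Mertens.integral_Ioi_inv_div_log_sq`), whence `D_K = C/log 2 + C(1 + 1/log 2)`.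

## References

* S. L. Aletheia-Zomlefer, L. Fukshansky, S. R. Garcia, *The Bateman–Horn conjecture: heuristics,
  history, and applications*, Expo. Math. 38 (2020), §5.3, Theorems 5.3.2 and 5.3.4.
  [AletheiaZomleferFukshanskyGarcia2020]
* G. H. Hardy, E. M. Wright, *An Introduction to the Theory of Numbers*, 6th ed., §22.7,
  eqs. (22.7.3)–(22.7.4), Thm 427; §22.8, Thm 428. [HardyWright2008]
* F. Mertens, J. reine angew. Math. 78 (1874), 46–62.
* H. L. Montgomery, R. C. Vaughan, *Multiplicative Number Theory I*, CUP 2007, Thm 8.9 and §6.2.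
  [MontgomeryVaughan2007]
* M. Rosen, *A generalization of Mertens' theorem*, J. Ramanujan Math. Soc. 14 (1999), 1–19;
  P. Lebacque, *Generalised Mertens and Brauer–Siegel theorems*, Acta Arith. 130 (2007), 333–350
  (the sources cited by AZFG for Thm. 5.3.4; not needed here).
-/

noncomputable section

namespace Literature.NumberTheory.Sieve

/-- **Discharge of `Literature.NumberTheory.Sieve.mertens_sum_inv_primes`** (AZFG 2020, Thm. 5.3.2 = Mertens 1874), with
`B = B₁` the Meissel–Mertens constant and `C = 8`. [cite: AletheiaZomleferFukshanskyGarcia2020, §5.3 Theorem 5.3.2] -/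
theorem mertens_sum_inv_primes_holds : mertens_sum_inv_primes := by
  refine ⟨Literature.NumberTheory.LFunctions.Mertens.meisselMertens, 8, fun x hx ↦ ?_⟩
  have h := Literature.NumberTheory.LFunctions.Mertens.abs_primeRecipSum_sub_le hx
  have e : ∑ p ∈ Nat.primesLE ⌊x⌋₊, (1 : ℝ) / p = Literature.NumberTheory.LFunctions.Mertens.primeRecipSum x := by
    simp [Literature.NumberTheory.LFunctions.Mertens.primeRecipSum, one_div]
  rw [e]
  exact h

/-! ### Mertens' theorem for number fields (Theorem 5.3.4): partial summation from `θ_K` -/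

namespace MertensNumberField

open Finset Real _root_.MeasureTheory _root_.Filter
open scoped NumberField
open LFunctions.NumberField (normPrimeIdealCount chebyshevThetaIdeal finite_primeIdealsLE)

section Algebra

variable (K : Type*) [Field K] [NumberField K]

/-- `∑_{N𝔭 ≤ x} 1/N𝔭 = ∑_{n ≤ x} G(n)/n` (`x ≥ 0`): the prime ideals of norm at most `x` regrouped
by their norm, `G(n) = #{𝔭 : N𝔭 = n}` being Landau's `normPrimeIdealCount`. [folklore] -/
theorem sum_inv_absNorm_eq_sum_div {x : ℝ} (hx : 0 ≤ x) :
    ∑ P ∈ (finite_primeIdealsLE K x).toFinset, (1 : ℝ) / Ideal.absNorm P =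
      ∑ n ∈ Icc 0 ⌊x⌋₊, (normPrimeIdealCount K n : ℝ) / n := by
  classical
  rw [← sum_fiberwise_of_maps_to (g := fun P => Ideal.absNorm P) (t := Icc 0 ⌊x⌋₊)
    (s := (finite_primeIdealsLE K x).toFinset)
    fun P hP => LFunctions.NumberField.absNorm_mem_Icc_of_mem_primeIdealsLE hP]
  refine sum_congr rfl fun n hn => ?_
  have hnx : (n : ℝ) ≤ x := (Nat.le_floor_iff hx).mp (mem_Icc.mp hn).2
  have h1 : ∑ P ∈ (finite_primeIdealsLE K x).toFinset with Ideal.absNorm P = n,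
      (1 : ℝ) / Ideal.absNorm P =
      ∑ P ∈ (finite_primeIdealsLE K x).toFinset with Ideal.absNorm P = n, (1 : ℝ) / n :=
    sum_congr rfl fun P hP => by rw [(mem_filter.mp hP).2]
  rw [h1, sum_const, nsmul_eq_mul, LFunctions.NumberField.card_filter_primeIdealsLE_absNorm_eq hnx]
  ring

/-- `θ_K` is measurable (a step function of `⌊t⌋₊`). [folklore] -/
theorem measurable_chebyshevThetaIdeal : Measurable (chebyshevThetaIdeal K) := by
  have h : chebyshevThetaIdeal K =
      (fun m : ℕ ↦ ∑ n ∈ Icc 0 m, (normPrimeIdealCount K n : ℝ) * Real.log n) ∘ Nat.floor := by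
    funext x
    simp only [Function.comp_apply, LFunctions.NumberField.chebyshevThetaIdeal]
  rw [h]
  exact (measurable_from_nat (f := fun m : ℕ ↦
    ∑ n ∈ Icc 0 m, (normPrimeIdealCount K n : ℝ) * Real.log n)).comp Nat.measurable_floor

/-- `d/dt (t log t)⁻¹ = −(log t + 1)/(t² log² t)` for `t > 1` (the Abel weight). [folklore] -/
theorem hasDerivAt_inv_mul_log {t : ℝ} (ht : 1 < t) :
    HasDerivAt (fun t : ℝ ↦ (t * Real.log t)⁻¹)
      (-((Real.log t + 1) / (t ^ 2 * Real.log t ^ 2))) t := by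
  have ht0 : t ≠ 0 := by positivity
  have hl : Real.log t ≠ 0 := (Real.log_pos ht).ne'
  have h1 : HasDerivAt (fun t : ℝ ↦ t * Real.log t) (1 * Real.log t + t * t⁻¹) t :=
    (hasDerivAt_id' t).mul (Real.hasDerivAt_log ht0)
  refine (h1.inv (mul_ne_zero ht0 hl)).congr_deriv ?_
  field_simp

/-- `d/dt (log log t − 1/log t) = t · (log t + 1)/(t² log² t)` for `t > 1` (the primitive of the
main term `t w(t)`). [folklore] -/
theorem hasDerivAt_loglog_sub_inv_log {t : ℝ} (ht : 1 < t) :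
    HasDerivAt (fun t : ℝ ↦ Real.log (Real.log t) - (Real.log t)⁻¹)
      (t * ((Real.log t + 1) / (t ^ 2 * Real.log t ^ 2))) t := by
  have ht0 : t ≠ 0 := by positivity
  have hl : Real.log t ≠ 0 := (Real.log_pos ht).ne'
  have h1 : HasDerivAt (fun t : ℝ ↦ Real.log (Real.log t)) (t⁻¹ / Real.log t) t :=
    (Real.hasDerivAt_log ht0).log hl
  have h2 : HasDerivAt (fun t : ℝ ↦ (Real.log t)⁻¹) (-t⁻¹ / Real.log t ^ 2) t :=
    (Real.hasDerivAt_log ht0).inv hl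
  refine (h1.sub h2).congr_deriv ?_
  field_simp
  ring

/-- The Abel weight `(log t + 1)/(t² log² t)` is continuous on `[2, x]`. [folklore] -/
theorem continuousOn_abelWeight (x : ℝ) :
    ContinuousOn (fun t : ℝ ↦ (Real.log t + 1) / (t ^ 2 * Real.log t ^ 2)) (Set.Icc 2 x) := by
  refine fun t ht ↦ ContinuousAt.continuousWithinAt ?_
  have h0 : t ≠ 0 := by linarith [ht.1]
  have h1 : t ^ 2 * Real.log t ^ 2 ≠ 0 := by
    have := Real.log_pos (by linarith [ht.1] : (1 : ℝ) < t)
    positivity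
  fun_prop (disch := assumption)

/-- **Partial summation** (Abel summation, Mathlib's `sum_mul_eq_sub_integral_mul₁`, with
`a_n = G(n) log n` and `f(t) = (t log t)⁻¹`): for `x ≥ 2`,
`∑_{n ≤ x} G(n)/n = θ_K(x)/(x log x) + ∫₂ˣ θ_K(t) (log t + 1)/(t² log² t) dt` (stated for all real
`x`: for `x < 2` both sides vanish). [folklore] -/
theorem sum_div_eq_theta_div_add_integral (x : ℝ) :
    ∑ n ∈ Icc 0 ⌊x⌋₊, (normPrimeIdealCount K n : ℝ) / n =
      chebyshevThetaIdeal K x / (x * Real.log x) +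
        ∫ t in Set.Ioc 2 x,
          chebyshevThetaIdeal K t * ((Real.log t + 1) / (t ^ 2 * Real.log t ^ 2)) := by
  set a : ℕ → ℝ := fun n ↦ (normPrimeIdealCount K n : ℝ) * Real.log n with ha
  have hθ : ∀ t : ℝ, ∑ k ∈ Icc 0 ⌊t⌋₊, a k = chebyshevThetaIdeal K t := fun t ↦ by
    simp only [ha, LFunctions.NumberField.chebyshevThetaIdeal]
  -- the left-hand side as `∑ f(n) a_n`
  have hlhs : ∑ n ∈ Icc 0 ⌊x⌋₊, (normPrimeIdealCount K n : ℝ) / n =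
      ∑ n ∈ Icc 0 ⌊x⌋₊, ((n : ℝ) * Real.log n)⁻¹ * a n := by
    refine sum_congr rfl fun n _ ↦ ?_
    rcases Nat.lt_or_ge n 2 with h | h
    · interval_cases n <;> simp [a]
    · have hn0 : (n : ℝ) ≠ 0 := by exact_mod_cast (by omega : n ≠ 0)
      have hln : Real.log n ≠ 0 :=
        Real.log_ne_zero_of_pos_of_ne_one (by exact_mod_cast (by omega : 0 < n))
          (by exact_mod_cast (by omega : n ≠ 1))
      simp only [a]
      field_simp
  have hf_diff : ∀ t ∈ Set.Icc 2 x, DifferentiableAt ℝ (fun t : ℝ ↦ (t * Real.log t)⁻¹) t :=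
    fun t ht ↦ (hasDerivAt_inv_mul_log (by linarith [ht.1])).differentiableAt
  have hderiv_eq : ∀ t ∈ Set.Icc 2 x, deriv (fun t : ℝ ↦ (t * Real.log t)⁻¹) t =
      -((Real.log t + 1) / (t ^ 2 * Real.log t ^ 2)) :=
    fun t ht ↦ (hasDerivAt_inv_mul_log (by linarith [ht.1])).deriv
  have hf_int : IntegrableOn (deriv (fun t : ℝ ↦ (t * Real.log t)⁻¹)) (Set.Icc 2 x) :=
    (continuousOn_abelWeight x).neg.integrableOn_Icc.congr_fun
      (fun t ht ↦ (hderiv_eq t ht).symm) measurableSet_Icc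
  have habel := sum_mul_eq_sub_integral_mul₁ a (f := fun t : ℝ ↦ (t * Real.log t)⁻¹)
    (by simp [a]) (by simp [a]) x hf_diff hf_int
  have hint : ∫ t in Set.Ioc 2 x, deriv (fun t : ℝ ↦ (t * Real.log t)⁻¹) t * ∑ k ∈ Icc 0 ⌊t⌋₊, a k =
      -∫ t in Set.Ioc 2 x,
        chebyshevThetaIdeal K t * ((Real.log t + 1) / (t ^ 2 * Real.log t ^ 2)) := by
    rw [← integral_neg]
    refine setIntegral_congr_fun measurableSet_Ioc fun t ht ↦ ?_
    rw [hderiv_eq t (Set.Ioc_subset_Icc_self ht), hθ]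
    ring
  rw [hlhs, habel, hint, hθ]
  ring

/-- The main term: `∫₂ˣ t · (log t + 1)/(t² log² t) dt = (log log x − 1/log x) − (log log 2 − 1/log 2)`
for `x ≥ 2` (fundamental theorem of calculus with `hasDerivAt_loglog_sub_inv_log`). [folklore] -/
theorem integral_self_mul_abelWeight {x : ℝ} (hx : 2 ≤ x) :
    ∫ t in Set.Ioc 2 x, t * ((Real.log t + 1) / (t ^ 2 * Real.log t ^ 2)) =
      (Real.log (Real.log x) - (Real.log x)⁻¹) - (Real.log (Real.log 2) - (Real.log 2)⁻¹) := by
  rw [← intervalIntegral.integral_of_le hx]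
  refine intervalIntegral.integral_eq_sub_of_hasDerivAt
    (fun t ht ↦ hasDerivAt_loglog_sub_inv_log ?_) ?_
  · rw [Set.uIcc_of_le hx] at ht
    linarith [ht.1]
  · refine ContinuousOn.intervalIntegrable ?_
    rw [Set.uIcc_of_le hx]
    exact continuousOn_id.mul (continuousOn_abelWeight x)

/-- Pointwise bound for the remainder integrand: if `|R| ≤ C t/log t` with `C ≥ 0` and `t ≥ 2`, then
`|R · (log t + 1)/(t² log² t)| ≤ C (1 + 1/log 2) · t⁻¹/log² t`. [folklore] -/
theorem abs_mul_abelWeight_le {R C t : ℝ} (hC : 0 ≤ C) (ht : 2 ≤ t)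
    (hR : |R| ≤ C * t / Real.log t) :
    |R * ((Real.log t + 1) / (t ^ 2 * Real.log t ^ 2))| ≤
      C * (1 + (Real.log 2)⁻¹) * (t⁻¹ / Real.log t ^ 2) := by
  have ht0 : 0 < t := by linarith
  have hl2 : 0 < Real.log 2 := Real.log_pos one_lt_two
  have hl : Real.log 2 ≤ Real.log t := Real.log_le_log two_pos ht
  have hl0 : 0 < Real.log t := hl2.trans_le hl
  have hw : 0 ≤ (Real.log t + 1) / (t ^ 2 * Real.log t ^ 2) := by positivity
  have hinv : (Real.log t)⁻¹ ≤ (Real.log 2)⁻¹ := inv_anti₀ hl2 hl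
  rw [abs_mul, abs_of_nonneg hw]
  calc |R| * ((Real.log t + 1) / (t ^ 2 * Real.log t ^ 2))
      ≤ C * t / Real.log t * ((Real.log t + 1) / (t ^ 2 * Real.log t ^ 2)) :=
        mul_le_mul_of_nonneg_right hR hw
    _ = C * (1 + (Real.log t)⁻¹) * (t⁻¹ / Real.log t ^ 2) := by
        field_simp
    _ ≤ C * (1 + (Real.log 2)⁻¹) * (t⁻¹ / Real.log t ^ 2) := by
        gcongr

end Algebra

section Analytic

variable (K : Type) [Field K] [NumberField K]

/-- From the tree's PROVED `θ_K`-form of the prime ideal theorem with de la Vallée-Poussin error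
term (`chebyshevThetaPrimeIdealTheorem_holds`: `|θ_K(t) − t| ≤ C t e^{−c√log t}`, Montgomery–Vaughan
Thm 8.9) only one logarithm is needed: there is `C ≥ 0` with `|θ_K(t) − t| ≤ C t/log t` for all
`t ≥ 2` (`logPow_of_expSqrt` with `A = 1`). [cite: MontgomeryVaughan2007, Thm 8.9 (p. 267)] -/
theorem exists_abs_theta_sub_le_div_log :
    ∃ C : ℝ, 0 ≤ C ∧ ∀ t : ℝ, 2 ≤ t → |chebyshevThetaIdeal K t - t| ≤ C * t / Real.log t := by
  obtain ⟨c, hc, C, hC⟩ := LFunctions.NumberField.chebyshevThetaPrimeIdealTheorem_holds K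
  have hC' : ∀ x : ℝ, 2 ≤ x →
      |chebyshevThetaIdeal K x - x| ≤ C * x / Real.exp (c * Real.sqrt (Real.log x)) := by
    intro x hx
    have h := hC x hx
    rwa [neg_mul, Real.exp_neg, ← div_eq_mul_inv] at h
  obtain ⟨C₁, hC₁⟩ := LFunctions.logPow_of_expSqrt hc hC' 1
  refine ⟨max C₁ 0, le_max_right _ _, fun t ht ↦ ?_⟩
  have hl : 0 < Real.log t := Real.log_pos (by linarith)
  have h := hC₁ t ht
  rw [Real.rpow_one] at h
  refine h.trans (div_le_div_of_nonneg_right ?_ hl.le)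
  exact mul_le_mul_of_nonneg_right (le_max_left _ _) (by linarith)

/-- The remainder integrand `(θ_K(t) − t)(log t + 1)/(t² log² t)` is integrable on `(2, ∞)`: it is
measurable and `O(1/(t log² t))` by `exists_abs_theta_sub_le_div_log`. [folklore] -/
theorem integrableOn_theta_sub_mul_abelWeight :
    IntegrableOn (fun t : ℝ ↦
      (chebyshevThetaIdeal K t - t) * ((Real.log t + 1) / (t ^ 2 * Real.log t ^ 2))) (Set.Ioi 2) := by
  obtain ⟨C, hC0, hC⟩ := exists_abs_theta_sub_le_div_log K
  have hmeas : Measurable fun t : ℝ ↦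
      (chebyshevThetaIdeal K t - t) * ((Real.log t + 1) / (t ^ 2 * Real.log t ^ 2)) :=
    ((measurable_chebyshevThetaIdeal K).sub measurable_id).mul
      ((Real.measurable_log.add_const 1).div
        ((measurable_id.pow_const 2).mul (Real.measurable_log.pow_const 2)))
  refine Integrable.mono'
    (LFunctions.Mertens.integrableOn_inv_div_log_sq.const_mul (C * (1 + (Real.log 2)⁻¹)))
    hmeas.aestronglyMeasurable ?_
  rw [ae_restrict_iff' measurableSet_Ioi]
  refine Eventually.of_forall fun t ht ↦ ?_
  have ht2 : (2 : ℝ) < t := ht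
  rw [Real.norm_eq_abs]
  exact abs_mul_abelWeight_le hC0 ht2.le (hC t ht2.le)

/-- **The exact formula behind Mertens' theorem for number fields**: for `x ≥ 2`,
`∑_{N𝔭 ≤ x} 1/N𝔭 − log log x − C_K = R(x)/(x log x) − ∫ₓ^∞ R(t)(log t + 1)/(t² log² t) dt`, where
`R = θ_K − id` and `C_K = 1/log 2 − log log 2 + ∫₂^∞ R(t)(log t + 1)/(t² log² t) dt`
(partial summation `sum_div_eq_theta_div_add_integral`, the main term
`integral_self_mul_abelWeight`, and `θ_K(x)/(x log x) = 1/log x + R(x)/(x log x)`). [folklore] -/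
theorem sum_inv_absNorm_sub_loglog_sub_eq {x : ℝ} (hx : 2 ≤ x) :
    ∑ P ∈ (finite_primeIdealsLE K x).toFinset, (1 : ℝ) / Ideal.absNorm P - Real.log (Real.log x) -
        ((Real.log 2)⁻¹ - Real.log (Real.log 2) + ∫ t in Set.Ioi 2,
          (chebyshevThetaIdeal K t - t) * ((Real.log t + 1) / (t ^ 2 * Real.log t ^ 2))) =
      (chebyshevThetaIdeal K x - x) / (x * Real.log x) - ∫ t in Set.Ioi x,
          (chebyshevThetaIdeal K t - t) * ((Real.log t + 1) / (t ^ 2 * Real.log t ^ 2)) := by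
  have hx0 : 0 < x := by linarith
  have hl : Real.log x ≠ 0 := (Real.log_pos (by linarith)).ne'
  have hI := integrableOn_theta_sub_mul_abelWeight K
  have hsplit : ∫ t in Set.Ioi 2,
      (chebyshevThetaIdeal K t - t) * ((Real.log t + 1) / (t ^ 2 * Real.log t ^ 2)) =
      (∫ t in Set.Ioc 2 x,
        (chebyshevThetaIdeal K t - t) * ((Real.log t + 1) / (t ^ 2 * Real.log t ^ 2))) +
      ∫ t in Set.Ioi x,
        (chebyshevThetaIdeal K t - t) * ((Real.log t + 1) / (t ^ 2 * Real.log t ^ 2)) := by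
    rw [← setIntegral_union (Set.Ioc_disjoint_Ioi le_rfl) measurableSet_Ioi
      (hI.mono_set Set.Ioc_subset_Ioi_self) (hI.mono_set (Set.Ioi_subset_Ioi hx)),
      Set.Ioc_union_Ioi_eq_Ioi hx]
  have hw_int : IntegrableOn (fun t : ℝ ↦ t * ((Real.log t + 1) / (t ^ 2 * Real.log t ^ 2)))
      (Set.Ioc 2 x) :=
    (continuousOn_id.mul (continuousOn_abelWeight x)).integrableOn_Icc.mono_set
      Set.Ioc_subset_Icc_self
  have hθsplit : ∫ t in Set.Ioc 2 x,
      chebyshevThetaIdeal K t * ((Real.log t + 1) / (t ^ 2 * Real.log t ^ 2)) =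
      (∫ t in Set.Ioc 2 x, t * ((Real.log t + 1) / (t ^ 2 * Real.log t ^ 2))) +
      ∫ t in Set.Ioc 2 x,
        (chebyshevThetaIdeal K t - t) * ((Real.log t + 1) / (t ^ 2 * Real.log t ^ 2)) := by
    rw [← integral_add hw_int (hI.mono_set Set.Ioc_subset_Ioi_self)]
    refine setIntegral_congr_fun measurableSet_Ioc fun t _ ↦ ?_
    ring
  rw [sum_inv_absNorm_eq_sum_div K hx0.le, sum_div_eq_theta_div_add_integral K x, hθsplit,
    integral_self_mul_abelWeight hx, hsplit]
  field_simp
  ring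

end Analytic

end MertensNumberField

open MertensNumberField _root_.MeasureTheory in
/-- **Discharge of `Literature.NumberTheory.Sieve.mertens_sum_inv_primeIdeals`** (AZFG 2020, Thm. 5.3.4 — Mertens'
theorem for number fields, there credited to Rosen 1999 / Lebacque 2007): for every number field
`K`, `|∑_{N𝔭 ≤ x} 1/N𝔭 − log log x − C_K| ≤ D_K/log x` for all `x ≥ 2`, with
`C_K = 1/log 2 − log log 2 + ∫₂^∞ (θ_K(t) − t)(log t + 1)/(t² log² t) dt` and
`D_K = C/log 2 + C(1 + 1/log 2)`, `C` the constant of `|θ_K(t) − t| ≤ C t/log t` (from the tree's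
PROVED prime ideal theorem `chebyshevThetaPrimeIdealTheorem_holds`).
[cite: AletheiaZomleferFukshanskyGarcia2020, §5.3 Theorem 5.3.4] -/
theorem mertens_sum_inv_primeIdeals_holds : mertens_sum_inv_primeIdeals := by
  intro K _ _
  obtain ⟨C, hC0, hC⟩ := exists_abs_theta_sub_le_div_log K
  have hl2 : 0 < Real.log 2 := Real.log_pos one_lt_two
  refine ⟨(Real.log 2)⁻¹ - Real.log (Real.log 2) + ∫ t in Set.Ioi 2,
      (LFunctions.NumberField.chebyshevThetaIdeal K t - t) *
        ((Real.log t + 1) / (t ^ 2 * Real.log t ^ 2)),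
    C / Real.log 2 + C * (1 + (Real.log 2)⁻¹), fun x hx ↦ ?_⟩
  have hx0 : 0 < x := by linarith
  have hl : 0 < Real.log x := Real.log_pos (by linarith)
  have hl2x : Real.log 2 ≤ Real.log x := Real.log_le_log two_pos hx
  rw [sum_inv_absNorm_sub_loglog_sub_eq K hx]
  -- the boundary term `|R(x)|/(x log x) ≤ C/log² x ≤ C/(log 2 · log x)`
  have h1 : |(LFunctions.NumberField.chebyshevThetaIdeal K x - x) / (x * Real.log x)| ≤
      C / Real.log 2 / Real.log x := by
    rw [abs_div, abs_of_pos (by positivity : 0 < x * Real.log x), div_le_iff₀ (by positivity)]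
    calc |LFunctions.NumberField.chebyshevThetaIdeal K x - x| ≤ C * x / Real.log x := hC x hx
      _ = C / Real.log x / Real.log x * (x * Real.log x) := by field_simp
      _ ≤ C / Real.log 2 / Real.log x * (x * Real.log x) := by gcongr
  -- the tail `|∫ₓ^∞ R w| ≤ C(1 + 1/log 2) ∫ₓ^∞ dt/(t log² t) = C(1 + 1/log 2)/log x`
  have h2 : |∫ t in Set.Ioi x, (LFunctions.NumberField.chebyshevThetaIdeal K t - t) *
      ((Real.log t + 1) / (t ^ 2 * Real.log t ^ 2))| ≤ C * (1 + (Real.log 2)⁻¹) / Real.log x := by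
    have hwint : IntegrableOn (fun t : ℝ ↦ t⁻¹ / Real.log t ^ 2) (Set.Ioi x) :=
      LFunctions.Mertens.integrableOn_inv_div_log_sq.mono_set (Set.Ioi_subset_Ioi hx)
    have hbound : ∀ᵐ t ∂(volume.restrict (Set.Ioi x)),
        ‖(LFunctions.NumberField.chebyshevThetaIdeal K t - t) *
          ((Real.log t + 1) / (t ^ 2 * Real.log t ^ 2))‖ ≤
          C * (1 + (Real.log 2)⁻¹) * (t⁻¹ / Real.log t ^ 2) := by
      rw [ae_restrict_iff' measurableSet_Ioi]
      refine Filter.Eventually.of_forall fun t ht ↦ ?_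
      have hxt : x < t := ht
      rw [Real.norm_eq_abs]
      exact abs_mul_abelWeight_le hC0 (by linarith) (hC t (by linarith))
    calc |∫ t in Set.Ioi x, (LFunctions.NumberField.chebyshevThetaIdeal K t - t) *
          ((Real.log t + 1) / (t ^ 2 * Real.log t ^ 2))|
        = ‖∫ t in Set.Ioi x, (LFunctions.NumberField.chebyshevThetaIdeal K t - t) *
          ((Real.log t + 1) / (t ^ 2 * Real.log t ^ 2))‖ := rfl
      _ ≤ ∫ t in Set.Ioi x, C * (1 + (Real.log 2)⁻¹) * (t⁻¹ / Real.log t ^ 2) :=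
          norm_integral_le_of_norm_le (hwint.const_mul _) hbound
      _ = C * (1 + (Real.log 2)⁻¹) / Real.log x := by
          rw [integral_const_mul, LFunctions.Mertens.integral_Ioi_inv_div_log_sq hx, div_eq_mul_inv]
  calc |(LFunctions.NumberField.chebyshevThetaIdeal K x - x) / (x * Real.log x) -
        ∫ t in Set.Ioi x, (LFunctions.NumberField.chebyshevThetaIdeal K t - t) *
          ((Real.log t + 1) / (t ^ 2 * Real.log t ^ 2))|
      ≤ |(LFunctions.NumberField.chebyshevThetaIdeal K x - x) / (x * Real.log x)| +
        |∫ t in Set.Ioi x, (LFunctions.NumberField.chebyshevThetaIdeal K t - t) *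
          ((Real.log t + 1) / (t ^ 2 * Real.log t ^ 2))| := abs_sub _ _
    _ ≤ C / Real.log 2 / Real.log x + C * (1 + (Real.log 2)⁻¹) / Real.log x := add_le_add h1 h2
    _ = (C / Real.log 2 + C * (1 + (Real.log 2)⁻¹)) / Real.log x := by ring

end Literature.NumberTheory.Sieve
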